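import Literature.NumberTheory.Transcendental.KontsevichZagier
import Literature.NumberTheory.Transcendental.MZVSimplexRepFubini
import Mathlib.Analysis.PSeries
import HarnessLib

/-!
# `ζ(k)` is a Kontsevich–Zagier period (discharge of `isPeriod_zetaValue`, `isPeriod_riemannZeta`)

Kontsevich–Zagier, *Periods* (2001), §1.1, display (2) and the sentence following it:
`ζ(3) = ∭_{0<x<y<z<1} dx dy dz / ((1-x) y z)`, "and more generally, all values of the Riemann zeta
function `ζ(s) := ∑_{n ≥ 1} n^{-s}` at integers `s ≥ 2` are periods". This file proves that
statement for the tree's definition `Literature.NumberTheory.Transcendental.IsRealPeriod`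
(rational integrand over a `ℚ`-semialgebraic domain, absolutely convergent):

* `KZ.MZVSimplex.wordLIntegral_replicate_append_true` — the polylogarithm ladder: for the binary
  word `0^j 1` and `0 ≤ x ≤ 1`,
  `∫⁻_{x > t₀ > ⋯ > t_j > 0} dt₀/t₀ ⋯ dt_{j-1}/t_{j-1} · dt_j/(1 - t_j) = ∑_{m ≥ 0} x^{m+1}/(m+1)^{j+1}`
  (`= Li_{j+1}(x)`), by induction on `j` from the slicing lemma
  `KZ.MZVSimplex.wordLIntegral_cons` and the one-variable steps of `MZVSimplexRepFubini.lean`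
  (geometric expansion of `1/(1-t)`, then `∫₀ˣ tᴺ⁻¹ dt = xᴺ/N`; monotone convergence throughout);
* `KZ.integral_openOrderedSimplex_zetaWord` — Kontsevich's formula in depth one:
  `∫_{1 > t₀ > ⋯ > t_{k-1} > 0} dt₀/t₀ ⋯ dt_{k-2}/t_{k-2} · dt_{k-1}/(1 - t_{k-1}) = ζ(k)` for
  `k ≥ 2` (Bochner integral, value `Literature.NumberTheory.Transcendental.zetaValue k`);
* `isRealPeriod_zetaValue`, and the discharges `isPeriod_zetaValue_holds`,
  `isPeriod_riemannZeta_holds` of the two named facts of `KontsevichZagier.lean`: the domain is the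
  open ordered simplex (`ℚ`-semialgebraic, `KZ.isSemialgebraic_openOrderedSimplex`), the integrand
  is `1 / (t₀ ⋯ t_{k-2} (1 - t_{k-1}))`, a quotient of polynomials over `ℚ` whose denominator does
  not vanish on the simplex, absolutely integrable there (`KZ.integrableOn_prod_mzvForm`).

No definition and no named fact is introduced; pure proofs on top of `MZVSimplexRep.lean` /
`MZVSimplexRepFubini.lean` (kept apart from `KontsevichZagierProofs.lean`, which discharges the
exponential-period facts of the same statements file with different imports).

## References

* M. Kontsevich, D. Zagier, *Periods*, in: Mathematics Unlimited — 2001 and Beyond, Springer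
  (2001), 771–808; §1.1, display (2) and the following sentence.
* D. Zagier, *Values of zeta functions and their applications*, First European Congress of
  Mathematics (Paris 1992), Vol. II, Birkhäuser (1994), 497–512; §9 (iterated integrals).
-/

noncomputable section

open MeasureTheory Set Filter ENNReal MvPolynomial

namespace Literature.NumberTheory.Transcendental

namespace KZ

namespace MZVSimplex

/-- **The polylogarithm ladder.** For the binary word `0^j 1` (the word of the index `(j+1)`) and
`0 ≤ x ≤ 1`, the iterated integral over the ordered simplex below `x` is
`∫⁻_{x > t₀ > ⋯ > t_j > 0} dt₀/t₀ ⋯ dt_{j-1}/t_{j-1} · dt_j/(1 - t_j) = ∑_{m ≥ 0} x^{m+1}/(m+1)^{j+1}`,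
i.e. `Li_{j+1}(x)`; induction on `j`: the letter `1` integrates the geometric series of
`1/(1-t)`, each letter `0` divides the `m`-th coefficient by `m + 1` (Zagier 1994, §9;
Kontsevich–Zagier 2001, §1.1). [cite: Zagier1994, §9] -/
theorem wordLIntegral_replicate_append_true (j : ℕ) {x : ℝ} (hx0 : 0 ≤ x) (hx1 : x ≤ 1) :
    ∫⁻ t in {t : Fin (j + 1) → ℝ | (∀ i, 0 < t i) ∧ (∀ i, t i < x) ∧ StrictAnti t},
        ∏ i : Fin (j + 1), ENNReal.ofReal
          (mzvForm ((List.replicate j false ++ [true]).getD i false) (t i)) =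
      ∑' m : ℕ, ENNReal.ofReal (x ^ (m + 1) / ((m + 1 : ℕ) : ℝ) ^ (j + 1)) := by
  induction j generalizing x with
  | zero =>
    rw [show List.replicate 0 false ++ [true] = true :: [] from rfl, wordLIntegral_cons]
    simp only [wordLIntegral_zero, mul_one, mzvForm_true]
    calc ∫⁻ t in Ioo 0 x, ENNReal.ofReal (1 / (1 - t))
        = ∫⁻ t in Ioo 0 x, ∑' m : ℕ, ENNReal.ofReal (t ^ m) :=
          setLIntegral_congr_fun measurableSet_Ioo fun t ht =>
            ofReal_one_div_one_sub ht.1.le (ht.2.trans_le hx1)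
      _ = ∑' m : ℕ, ∫⁻ t in Ioo 0 x, ENNReal.ofReal (t ^ m) :=
          lintegral_tsum fun m => (measurable_ofReal_pow m).aemeasurable
      _ = ∑' m : ℕ, ENNReal.ofReal (x ^ (m + 1) / ((m + 1 : ℕ) : ℝ) ^ (0 + 1)) := by
          refine tsum_congr fun m => ?_
          rw [lintegral_pow_Ioo m hx0]
          push_cast
          ring_nf
  | succ j ih =>
    rw [show List.replicate (j + 1) false ++ [true] =
        false :: (List.replicate j false ++ [true]) from rfl, wordLIntegral_cons]
    calc ∫⁻ t₀ in Ioo 0 x, ENNReal.ofReal (mzvForm false t₀) *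
          ∫⁻ t in {t : Fin (j + 1) → ℝ | (∀ i, 0 < t i) ∧ (∀ i, t i < t₀) ∧ StrictAnti t},
            ∏ i : Fin (j + 1), ENNReal.ofReal
              (mzvForm ((List.replicate j false ++ [true]).getD i false) (t i))
        = ∫⁻ t₀ in Ioo 0 x, ENNReal.ofReal (1 / t₀) *
            ∑' m : ℕ, ENNReal.ofReal (1 / ((m + 1 : ℕ) : ℝ) ^ (j + 1)) *
              ENNReal.ofReal (t₀ ^ (m + 1)) := by
          refine setLIntegral_congr_fun measurableSet_Ioo fun t₀ ht => ?_
          rw [mzvForm_false, ih ht.1.le (ht.2.le.trans hx1)]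
          congr 1
          refine tsum_congr fun m => ?_
          rw [← ENNReal.ofReal_mul (by positivity)]
          congr 1
          ring
      _ = ∑' m : ℕ, ENNReal.ofReal (1 / ((m + 1 : ℕ) : ℝ) ^ (j + 1)) *
            ENNReal.ofReal (x ^ (m + 1) / ((m + 1 : ℕ) : ℝ)) :=
          lintegral_inv_mul_tsum _ (fun m => m + 1) (fun m => Nat.succ_pos m) hx0
      _ = ∑' m : ℕ, ENNReal.ofReal (x ^ (m + 1) / ((m + 1 : ℕ) : ℝ) ^ (j + 1 + 1)) := by
          refine tsum_congr fun m => ?_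
          rw [← ENNReal.ofReal_mul (by positivity)]
          congr 1
          rw [div_mul_div_comm, one_mul, ← pow_succ]

end MZVSimplex

/-- The integrand `∏ᵢ ω_{εᵢ}(tᵢ)` of a word `ε` is the quotient `1 / ∏ᵢ qᵢ` of polynomials over `ℚ`,
`qᵢ = Xᵢ` for the letter `0` and `qᵢ = 1 - Xᵢ` for the letter `1` (an identity on all of `ℝ^w`,
junk value `1 / 0 = 0` on both sides; cf. `KZ.mzvIntegrand_eq_aeval_div_aeval`).
[Kontsevich–Zagier 2001, §1.1: "rational functions with rational coefficients"] [folklore] -/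
theorem prod_mzvForm_eq_aeval_div_aeval (w : ℕ) (ε : ℕ → Bool) (t : Fin w → ℝ) :
    ∏ i : Fin w, mzvForm (ε i) (t i) = aeval t (1 : MvPolynomial (Fin w) ℚ) /
      aeval t (∏ i : Fin w, (if ε i then 1 - X i else X i : MvPolynomial (Fin w) ℚ)) := by
  simp only [mzvForm, map_one, map_prod, one_div, ← Finset.prod_inv_distrib]
  refine Finset.prod_congr rfl fun i _ => ?_
  split_ifs <;> simp

/-- On the open ordered simplex the denominator `∏ᵢ qᵢ` (`qᵢ ∈ {Xᵢ, 1 - Xᵢ}`) does not vanish,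
since `0 < tᵢ < 1` there (cf. `KZ.aeval_prod_ne_zero_of_mem_openOrderedSimplex`). [folklore] -/
theorem aeval_prod_letters_ne_zero (w : ℕ) (ε : ℕ → Bool) {t : Fin w → ℝ}
    (ht : t ∈ openOrderedSimplex w) :
    aeval t (∏ i : Fin w, (if ε i then 1 - X i else X i : MvPolynomial (Fin w) ℚ)) ≠ 0 := by
  obtain ⟨h0, h1, -⟩ := ht
  rw [map_prod]
  refine Finset.prod_ne_zero_iff.mpr fun i _ => ?_
  split_ifs
  · simpa [sub_eq_zero] using (h1 i).ne'
  · simpa using (h0 i).ne'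

/-- `∑_{m ≥ 0} (m+1)^{-k} = ζ(k)` for `k ≥ 2`: the series `zetaValue k = ∑_{n ≥ 0} n^{-k}` with its
vanishing `n = 0` term (`1 / 0 ^ k = 0`) removed. [folklore] -/
theorem tsum_one_div_succ_pow_eq_zetaValue {k : ℕ} (hk : 1 < k) :
    ∑' m : ℕ, 1 / ((m + 1 : ℕ) : ℝ) ^ k = zetaValue k := by
  rw [zetaValue, (Real.summable_one_div_nat_pow.mpr hk).tsum_eq_zero_add]
  simp [zero_pow (by omega : k ≠ 0)]

/-- The shifted zeta series `∑_{m ≥ 0} (m+1)^{-k}` is summable for `k ≥ 2`. [folklore] -/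
theorem summable_one_div_succ_pow {k : ℕ} (hk : 1 < k) :
    Summable fun m : ℕ => 1 / ((m + 1 : ℕ) : ℝ) ^ k :=
  (summable_nat_add_iff (f := fun n : ℕ => 1 / (n : ℝ) ^ k) 1).mpr
    (Real.summable_one_div_nat_pow.mpr hk)

/-- **Kontsevich's formula in depth one**, `ℝ≥0∞` form: for the word `0^j 1`,
`∫⁻_{1 > t₀ > ⋯ > t_j > 0} dt₀/t₀ ⋯ dt_{j-1}/t_{j-1} · dt_j/(1 - t_j) = ∑_{m ≥ 0} (m+1)^{-(j+1)}`
(the polylogarithm ladder at `x = 1`). [Kontsevich–Zagier 2001, §1.1 (2); Zagier 1994, §9]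
[cite: KontsevichZagier2001, §1.1 (2)] -/
theorem lintegral_openOrderedSimplex_zetaWord (j : ℕ) :
    ∫⁻ t in openOrderedSimplex (j + 1), ENNReal.ofReal
        (∏ i : Fin (j + 1), mzvForm ((List.replicate j false ++ [true]).getD i false) (t i)) =
      ∑' m : ℕ, ENNReal.ofReal (1 / ((m + 1 : ℕ) : ℝ) ^ (j + 1)) := by
  have h1 := MZVSimplex.wordLIntegral_replicate_append_true j zero_le_one (le_refl (1 : ℝ))
  simp only [one_pow] at h1
  rw [← h1]
  refine setLIntegral_congr_fun (measurableSet_openOrderedSimplex _) fun t ht => ?_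
  exact ENNReal.ofReal_prod_of_nonneg fun i _ => (mzvForm_pos _ (ht.1 i) (ht.2.1 i)).le

/-- **Kontsevich's formula in depth one** (`ζ(k)` as an iterated integral, `k = j + 2 ≥ 2`):
`∫_{1 > t₀ > ⋯ > t_{k-1} > 0} dt₀/t₀ ⋯ dt_{k-2}/t_{k-2} · dt_{k-1}/(1 - t_{k-1}) = ζ(k)`, the case
`ζ(3) = ∭_{0<x<y<z<1} dx dy dz / ((1-x) y z)` being display (2) of Kontsevich–Zagier 2001, §1.1.
Obtained from the `ℝ≥0∞` version (nonnegative integrand) and `∑_{m ≥ 0} (m+1)^{-k} = ζ(k)`.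
[cite: KontsevichZagier2001, §1.1 (2)] -/
theorem integral_openOrderedSimplex_zetaWord (j : ℕ) :
    ∫ t in openOrderedSimplex (j + 1 + 1), ∏ i : Fin (j + 1 + 1),
        mzvForm ((List.replicate (j + 1) false ++ [true]).getD i false) (t i) =
      zetaValue (j + 1 + 1) := by
  have hk : 1 < j + 1 + 1 := by omega
  have hmeas : Measurable fun t : Fin (j + 1 + 1) → ℝ => ∏ i : Fin (j + 1 + 1),
      mzvForm ((List.replicate (j + 1) false ++ [true]).getD i false) (t i) :=
    Finset.measurable_prod _ fun i _ => (measurable_mzvForm _).comp (measurable_pi_apply i)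
  have hnn : 0 ≤ᵐ[volume.restrict (openOrderedSimplex (j + 1 + 1))]
      fun t : Fin (j + 1 + 1) → ℝ => ∏ i : Fin (j + 1 + 1),
        mzvForm ((List.replicate (j + 1) false ++ [true]).getD i false) (t i) :=
    (ae_restrict_mem (measurableSet_openOrderedSimplex _)).mono fun t ht =>
      Finset.prod_nonneg fun i _ => (mzvForm_pos _ (ht.1 i) (ht.2.1 i)).le
  rw [integral_eq_lintegral_of_nonneg_ae hnn hmeas.aestronglyMeasurable,
    lintegral_openOrderedSimplex_zetaWord (j + 1),
    ← ENNReal.ofReal_tsum_of_nonneg (fun m => by positivity) (summable_one_div_succ_pow hk),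
    ENNReal.toReal_ofReal (tsum_nonneg fun m => by positivity),
    tsum_one_div_succ_pow_eq_zetaValue hk]

end KZ

/-- **`ζ(k)` is a real period for `k ≥ 2`** (Kontsevich–Zagier 2001, §1.1, (2) and the sentence
following it: "all values of the Riemann zeta function at integers `s ≥ 2` are periods"). The
datum: dimension `k`, domain the open ordered simplex `1 > t₀ > ⋯ > t_{k-1} > 0`
(`ℚ`-semialgebraic), integrand `1 / (t₀ ⋯ t_{k-2} (1 - t_{k-1}))` — numerator `1`, denominator a
product of the letters `Xᵢ`, `1 - Xᵢ` over `ℚ`, non-vanishing on the simplex — absolutely integrable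
(`KZ.integrableOn_prod_mzvForm`), with value `ζ(k)` (`KZ.integral_openOrderedSimplex_zetaWord`).
[cite: KontsevichZagier2001, §1.1 (2)] -/
theorem isRealPeriod_zetaValue {k : ℕ} (hk : 2 ≤ k) : IsRealPeriod (zetaValue k) := by
  obtain ⟨j, rfl⟩ : ∃ j, k = j + 1 + 1 := ⟨k - 2, by omega⟩
  refine ⟨j + 1 + 1, KZ.openOrderedSimplex (j + 1 + 1), 1,
    ∏ i : Fin (j + 1 + 1),
      (if (List.replicate (j + 1) false ++ [true]).getD i false then 1 - X i else X i),
    KZ.isSemialgebraic_openOrderedSimplex _,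
    fun t ht => KZ.aeval_prod_letters_ne_zero (j + 1 + 1)
      (fun i => (List.replicate (j + 1) false ++ [true]).getD i false) ht, ?_, ?_⟩
  · have hint := KZ.integrableOn_prod_mzvForm (j + 1 + 1)
      (fun i => (List.replicate (j + 1) false ++ [true]).getD i false) (fun _ => rfl)
      (fun _ => by simp)
    exact hint.congr_fun (fun t _ => KZ.prod_mzvForm_eq_aeval_div_aeval (j + 1 + 1)
      (fun i => (List.replicate (j + 1) false ++ [true]).getD i false) t)
      (KZ.measurableSet_openOrderedSimplex _)
  · rw [← KZ.integral_openOrderedSimplex_zetaWord j]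
    exact setIntegral_congr_fun (KZ.measurableSet_openOrderedSimplex _) fun t _ =>
      KZ.prod_mzvForm_eq_aeval_div_aeval (j + 1 + 1)
        (fun i => (List.replicate (j + 1) false ++ [true]).getD i false) t

/-- **Discharge of `isPeriod_zetaValue`** (periods.S06): for `k ≥ 2` the real zeta value
`ζ(k) = ∑_{n ≥ 1} n^{-k}` is a Kontsevich–Zagier period — Kontsevich–Zagier 2001, §1.1, display
(2) `ζ(3) = ∭_{0<x<y<z<1} dx dy dz/((1-x)yz)` "and more generally, all values of the Riemann zeta
function at integers `s ≥ 2` are periods" — via `isRealPeriod_zetaValue` and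
`isPeriod_ofReal_iff`. [cite: KontsevichZagier2001, §1.1 (2)] -/
theorem isPeriod_zetaValue_holds : isPeriod_zetaValue :=
  fun _k hk => isPeriod_ofReal_iff.2 (isRealPeriod_zetaValue hk)

/-- **Discharge of `isPeriod_riemannZeta`** (periods.S06): for an integer `k ≥ 2`, Mathlib's
`riemannZeta k` is a Kontsevich–Zagier period, since `riemannZeta k = (zetaValue k : ℂ)`
(`ofReal_zetaValue`) and `zetaValue k` is a period (`isPeriod_zetaValue_holds`).
[cite: KontsevichZagier2001, §1.1 (2)] -/
theorem isPeriod_riemannZeta_holds : isPeriod_riemannZeta := by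
  intro k hk
  rw [← ofReal_zetaValue (by omega)]
  exact isPeriod_zetaValue_holds k hk

end Literature.NumberTheory.Transcendental
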